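import Summits.QuantumFields.BalabanUV.T4Continuum.Support.RegionBoxCollarCutoff

/-!
# `BalabanUV.T4Continuum.Support.RegionBoxCollarLift` — NE2 (node U1a) formalisation swarm, SUPPLIER item «Δ1-VEC-W1-HOLED» v3 under the
# owner's sub-row `T4-U1a.S-NE2-D1-DIRICHLET°` (vector layer W1): THE GRADIENT OF THE BOX-COLLAR LIFT IS PAID BY THE BOX-INTERNAL DATA —
# `nsq (∂ (lift g)) ≤ 2·3^d·Σ_{i,ρ} GK_{i,ρ} g + 2d·3^d·Σ_i mass_i g` «not in print; our construction» (unit b2b-balaban-t4-ne2-formalise-leaf-09, gen 9, v1)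

HONEST FRAMING (T4-DAG p. 1).  [folklore] the summation half for a box of blocks: torus sums over the collar are chart sums over
`KOff × {digits}`; per offset `k` the fold reads the block `clamp k` of the box injectively (mass) and its image bonds are box-internal bonds
based in that block (in-block bonds, identity or reversed; inter-block bonds for the crossings between adjacent blocks of the box); the
offsets with the same clamped block are at most `3^d` (`sum_clamp_le`).  Nothing printed is a hypothesis; NE2 (U1a) NOT proved; spine PROVED 0/9
unchanged; NOT [B9] (3.23)–(3.27) as printed; NOT infinite volume, NOT the mass gap, NOT Clay.  HONEST DEPENDENCY (verbatim): «continuum YM on T⁴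
⇐ BetaPertH ∧ nine spine estimates (0/9 proved); BetaPertH ⇐ (D1) ∧ (D4) ∧ CAP+tail; G-an2-4 gates asym, D1 and NE2/3/4.»

ABSOLUTE RULE (cell, verbatim): «No internally-minted statement may enter as a cited fact. Every hypothesis is either kernel-proved in
this package or a verbatim quotation of a PUBLISHED theorem with page reference. The manuscript(s) under audit are NOT citable for
their own disputed steps — they are the thing under adjudication; programme-internal (2001/route/tribunal) claims are never citable.»
[folklore] throughout; data defs `KIn` (a `Finset`), `GK`, `massK` (sums); no `def … : Prop`.  NOT CLAIMED: anything about the operator yet.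
-/

noncomputable section

open scoped BigOperators ComplexConjugate Matrix
open Finset

namespace Summit.QuantumFields.BalabanUV.T4Continuum.RegionBoxCollarLift

open Literature.MathematicalPhysics.QuantumFieldTheory.Balaban1983to89.B5Prop11Plancherel (Tor fine unitVec)
open Literature.MathematicalPhysics.QuantumFieldTheory.Balaban1983to89.B5Prop11Lower (nsq nsq_nonneg)
open Literature.MathematicalPhysics.QuantumFieldTheory.Balaban1983to89.B5Action121 (GradOp GradOp_mulVec sdiff sdiff_mulVec)
open Literature.MathematicalPhysics.QuantumFieldTheory.Balaban1983to89.B5Block118 (bpt)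
open Summit.QuantumFields.BalabanUV.T4Continuum
open Summit.QuantumFields.BalabanUV.T4Continuum.ScalarBlockTrialFunction (digits digits_bpt)
open Summit.QuantumFields.BalabanUV.T4Continuum.RegionCollarFold (koff)
open Summit.QuantumFields.BalabanUV.T4Continuum.RegionCollarLift (predD)
open Summit.QuantumFields.BalabanUV.T4Continuum.RegionBoxCollarFold
open Summit.QuantumFields.BalabanUV.T4Continuum.RegionBoxCollarCutoff

variable {d : ℕ} (n : ℕ) [NeZero n] (M : Fin d → ℕ) [hM : ∀ μ, NeZero (M μ)] (lo : Tor M) (len : Fin d → ℕ)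

/-! ## §1 Torus sums over the box collar are chart sums -/

/-- **A FUNCTION VANISHING OFF THE COLLAR SUMS OVER THE CHART** (`len_ν + 2 ≤ M_ν`). [folklore] -/
theorem sum_collarB_eq (hM2 : ∀ μ, len μ + 2 ≤ M μ) (f : Tor (fine n M) → ℝ) (hf : ∀ x, x ∉ collarB n M lo len → f x = 0) :
    ∑ x, f x = ∑ k ∈ KOff len, ∑ j : Fin d → Fin n, f (csiteB n M lo k j) := by
  classical
  rw [← Finset.sum_product' (f := fun k j => f (csiteB n M lo k j)), ← Finset.sum_image (f := f) (csiteB_injOn n M lo len hM2)]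
  symm
  refine Finset.sum_subset (subset_univ _) fun x _ hx => hf x fun hxc => hx ?_
  exact mem_image.2 ⟨(koff n M lo x, digits n M x), Finset.mem_product.2 ⟨koffB_mem_KOff n M lo len hxc, mem_univ _⟩,
    csiteB_koff n M lo x⟩

/-! ## §2 Box-internal data and the per-offset bounds -/

/-- the inside index set `1 ≤ i_ν ≤ len_ν` (the blocks of the box). [folklore] -/
def KIn : Finset (Fin d → ℕ) := Fintype.piFinset fun ν => Icc 1 (len ν)

omit hM in
/-- membership. [folklore] -/
@[simp] theorem mem_KIn {i : Fin d → ℕ} : i ∈ KIn len ↔ ∀ ν, 1 ≤ i ν ∧ i ν ≤ len ν := by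
  simp [KIn, Fintype.mem_piFinset]

omit hM in
/-- inside indices are collar offsets. [folklore] -/
theorem KIn_subset_KOff : KIn len ⊆ KOff len := fun i hi => (mem_KOff len).2 fun ν => by have := ((mem_KIn len).1 hi ν).2; omega

omit hM in
/-- the clamp maps collar offsets to inside indices (`1 ≤ len_ν`). [folklore] -/
theorem clampK_mem_KIn (hlen : ∀ ν, 1 ≤ len ν) (k : Fin d → ℕ) : clampK len k ∈ KIn len :=
  (mem_KIn len).2 fun ν => clampN_mem (hlen ν) (k ν)

/-- the BOX-INTERNAL gradient sum of `g` based in block `i`, direction `ρ`: in-block bonds and — if `i + e_ρ` is still a block of the box —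
the bonds crossing into it. [folklore] -/
def GK (g : Tor (fine n M) → ℂ) (i : Fin d → ℕ) (ρ : Fin d) : ℝ :=
  ∑ j ∈ univ.filter (fun j : Fin d → Fin n => (j ρ : ℕ) + 1 < n ∨ i ρ + 1 ≤ len ρ), ‖(sdiff (fine n M) (n : ℂ) ρ *ᵥ g) (csiteB n M lo i j)‖ ^ 2

/-- the mass of `g` on block `i`. [folklore] -/
def massK (g : Tor (fine n M) → ℂ) (i : Fin d → ℕ) : ℝ := ∑ j : Fin d → Fin n, ‖g (csiteB n M lo i j)‖ ^ 2

omit [NeZero n] hM in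
/-- reading a block through the fold of one offset does not increase a nonnegative site sum. [folklore] -/
theorem sum_foldDB_le (k : Fin d → ℕ) (h : (Fin d → Fin n) → ℝ) (hh : ∀ j, 0 ≤ h j) : ∑ j, h (foldDB n len k j) ≤ ∑ j, h j := by
  classical
  rw [← Finset.sum_image (f := h) (fun a _ b _ hab => foldDB_injective n len k hab)]
  exact sum_le_sum_of_subset_of_nonneg (subset_univ _) fun j _ _ => hh j

/-- **INSIDE DIRECTION** (`1 ≤ k_ρ ≤ len_ρ`): the image bonds of offset `k` are box-internal bonds based in block `clamp k` (identity on the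
digits; in-block steps and the crossing). [folklore] -/
theorem sum_DtermB_le_of_in (hM2 : ∀ μ, len μ + 2 ≤ M μ) (g : Tor (fine n M) → ℂ) {k : Fin d → ℕ}
    (hk : k ∈ KOff len) (ρ : Fin d) (hin : 1 ≤ k ρ ∧ k ρ ≤ len ρ) :
    ∑ j, DtermB n M lo len g k j ρ ≤ GK n M lo len g (clampK len k) ρ := by
  classical
  have hkM := lt_M_of_mem_KOff M len hM2 hk
  have hcl : clampK len k ρ = k ρ := clampN_of_inside hin.1 hin.2
  set T := univ.filter (fun j : Fin d → Fin n => (j ρ : ℕ) + 1 < n ∨ (1 ≤ k ρ ∧ k ρ + 1 ≤ len ρ)) with hT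
  -- only the steps counted in `Dterm` contribute, and each reads the SAME bond of the box at the folded site
  have hsplit : ∑ j, DtermB n M lo len g k j ρ
      = ∑ j ∈ T, ‖(sdiff (fine n M) (n : ℂ) ρ *ᵥ g) (csiteB n M lo (clampK len k) (foldDB n len k j))‖ ^ 2 := by
    rw [← Finset.sum_filter_add_sum_filter_not univ (fun j : Fin d → Fin n => (j ρ : ℕ) + 1 < n ∨ (1 ≤ k ρ ∧ k ρ + 1 ≤ len ρ))]
    have h0 : ∑ j ∈ univ.filter (fun j : Fin d → Fin n => ¬ ((j ρ : ℕ) + 1 < n ∨ (1 ≤ k ρ ∧ k ρ + 1 ≤ len ρ))),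
        DtermB n M lo len g k j ρ = 0 := sum_eq_zero fun j hj => by rw [DtermB, if_neg (mem_filter.1 hj).2]
    rw [h0, add_zero]
    refine sum_congr rfl fun j hj => ?_
    have hc := (mem_filter.1 hj).2
    have hstep : foldB n M lo len (csiteB n M lo k j + unitVec (fine n M) ρ) = foldB n M lo len (csiteB n M lo k j) + unitVec (fine n M) ρ := by
      by_cases hlt : (j ρ : ℕ) + 1 < n
      · exact foldB_step_in n M lo len hM2 hk j ρ hlt hin
      · have heq : (j ρ : ℕ) + 1 = n := by have := (j ρ).isLt; omega
        have hin' : 1 ≤ k ρ ∧ k ρ + 1 ≤ len ρ := hc.resolve_left hlt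
        exact foldB_cross_in n M lo len hM2 hk j ρ heq hin'
    rw [DtermB, if_pos hc, hstep, foldB_csiteB n M lo len k hkM, sdiff_mulVec, norm_mul, Complex.norm_natCast, mul_pow]
  rw [hsplit, GK, ← Finset.sum_image (f := fun j => ‖(sdiff (fine n M) (n : ℂ) ρ *ᵥ g) (csiteB n M lo (clampK len k) j)‖ ^ 2)
    (fun a _ b _ hab => foldDB_injective n len k hab)]
  refine sum_le_sum_of_subset_of_nonneg (fun j' hj' => ?_) fun _ _ _ => by positivity
  obtain ⟨j, hj, rfl⟩ := mem_image.1 hj'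
  have hc := (mem_filter.1 hj).2
  refine mem_filter.2 ⟨mem_univ _, ?_⟩
  have hρ : (foldDB n len k j ρ : ℕ) = (j ρ : ℕ) := by simp only [foldDB, if_pos hin]
  rw [hρ, hcl]
  rcases hc with h | h
  · exact Or.inl h
  · exact Or.inr h.2

/-- **OUTSIDE DIRECTION** (`k_ρ ∉ [1, len_ρ]`): the image bonds are the REVERSED in-block bonds of block `clamp k`. [folklore] -/
theorem sum_DtermB_le_of_out (hM2 : ∀ μ, len μ + 2 ≤ M μ) (g : Tor (fine n M) → ℂ) {k : Fin d → ℕ} (hk : k ∈ KOff len) (ρ : Fin d)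
    (hout : ¬ (1 ≤ k ρ ∧ k ρ ≤ len ρ)) :
    ∑ j, DtermB n M lo len g k j ρ ≤ GK n M lo len g (clampK len k) ρ := by
  classical
  have hkM := lt_M_of_mem_KOff M len hM2 hk
  set B := clampK len k with hB
  set G : (Fin d → Fin n) → ℝ := fun j => ‖(sdiff (fine n M) (n : ℂ) ρ *ᵥ g) (csiteB n M lo B j)‖ ^ 2 with hG
  set H : (Fin d → Fin n) → ℝ := fun j' => G (predD n ρ j') with hH
  have hno : ¬ (1 ≤ k ρ ∧ k ρ + 1 ≤ len ρ) := fun h => hout ⟨h.1, by omega⟩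
  -- (1) only in-block steps contribute; each reads the reversed bond below the folded site
  have hsplit : ∑ j, DtermB n M lo len g k j ρ = ∑ j ∈ univ.filter (fun j : Fin d → Fin n => (j ρ : ℕ) + 1 < n), H (foldDB n len k j) := by
    rw [← Finset.sum_filter_add_sum_filter_not univ (fun j : Fin d → Fin n => (j ρ : ℕ) + 1 < n)]
    have h0 : ∑ j ∈ univ.filter (fun j : Fin d → Fin n => ¬ ((j ρ : ℕ) + 1 < n)), DtermB n M lo len g k j ρ = 0 :=
      sum_eq_zero fun j hj => by
        rw [DtermB, if_neg]
        intro h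
        rcases h with h | h
        · exact (mem_filter.1 hj).2 h
        · exact hno h
    rw [h0, add_zero]
    refine sum_congr rfl fun j hj => ?_
    have hlt := (mem_filter.1 hj).2
    have hy' : foldB n M lo len (csiteB n M lo k j + unitVec (fine n M) ρ) = csiteB n M lo B (predD n ρ (foldDB n len k j)) := by
      rw [csiteB_add_unitVec_of_lt n M lo k j ρ hlt, foldB_csiteB n M lo len k hkM]
      congr 1
      funext μ
      simp only [foldDB, predD, Function.update_apply]
      by_cases hμ : μ = ρ
      · subst hμ; simp only [if_true, if_neg hout]; apply Fin.ext; simp only [Fin.val_rev]; omega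
      · simp only [if_neg hμ]
    have hstep := foldB_step_out n M lo len hM2 hk j ρ hlt hout
    rw [DtermB, if_pos (Or.inl hlt), hH, hG]
    simp only
    rw [← hy', hstep, norm_sub_rev, sdiff_mulVec, norm_mul, Complex.norm_natCast, mul_pow]
  rw [hsplit]
  -- (2) reindex by the fold into `{1 ≤ j'_ρ}`
  have h2 : ∑ j ∈ univ.filter (fun j : Fin d → Fin n => (j ρ : ℕ) + 1 < n), H (foldDB n len k j)
      ≤ ∑ j' ∈ univ.filter (fun j' : Fin d → Fin n => 1 ≤ (j' ρ : ℕ)), H j' := by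
    rw [← Finset.sum_image (f := H) (fun a _ b _ hab => foldDB_injective n len k hab)]
    refine sum_le_sum_of_subset_of_nonneg (fun j' hj' => ?_) fun _ _ _ => by positivity
    obtain ⟨j, hj, rfl⟩ := mem_image.1 hj'
    have hlt := (mem_filter.1 hj).2
    refine mem_filter.2 ⟨mem_univ _, ?_⟩
    simp only [foldDB, if_neg hout, Fin.val_rev]
    omega
  -- (3) reindex by the predecessor into the box-internal set (first disjunct)
  have h3 : ∑ j' ∈ univ.filter (fun j' : Fin d → Fin n => 1 ≤ (j' ρ : ℕ)), H j' ≤ GK n M lo len g B ρ := by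
    have hinj : Set.InjOn (predD n ρ) ↑(univ.filter (fun j' : Fin d → Fin n => 1 ≤ (j' ρ : ℕ))) := by
      intro a ha b hb hab
      have ha1 : 1 ≤ (a ρ : ℕ) := (mem_filter.1 ha).2
      have hb1 : 1 ≤ (b ρ : ℕ) := (mem_filter.1 hb).2
      funext μ
      have hμ := congrFun hab μ
      by_cases hμρ : μ = ρ
      · subst hμρ
        simp only [predD, Function.update_self, Fin.mk.injEq] at hμ
        apply Fin.ext; omega
      · simpa only [predD, Function.update_of_ne hμρ] using hμ
    rw [hH, ← Finset.sum_image (f := G) hinj, GK]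
    refine sum_le_sum_of_subset_of_nonneg (fun j'' hj'' => ?_) fun _ _ _ => by positivity
    obtain ⟨j', hj', rfl⟩ := mem_image.1 hj''
    have h1 : 1 ≤ (j' ρ : ℕ) := (mem_filter.1 hj').2
    refine mem_filter.2 ⟨mem_univ _, Or.inl ?_⟩
    simp only [predD, Function.update_self]
    have := (j' ρ).isLt
    omega
  exact h2.trans h3

/-- both cases. [folklore] -/
theorem sum_DtermB_le (hM2 : ∀ μ, len μ + 2 ≤ M μ) (g : Tor (fine n M) → ℂ) {k : Fin d → ℕ} (hk : k ∈ KOff len)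
    (ρ : Fin d) : ∑ j, DtermB n M lo len g k j ρ ≤ GK n M lo len g (clampK len k) ρ := by
  by_cases hin : 1 ≤ k ρ ∧ k ρ ≤ len ρ
  · exact sum_DtermB_le_of_in n M lo len hM2 g hk ρ hin
  · exact sum_DtermB_le_of_out n M lo len hM2 g hk ρ hin

/-! ## §3 At most `3^d` offsets share a clamped block -/

omit [NeZero n] hM in
/-- the clamp fibre in one coordinate: `clampN l t = i` with `t < l + 2`, `1 ≤ i` forces `t ∈ {i−1, i, i+1}`. [folklore] -/
theorem clampN_fibre {l t i : ℕ} (ht : t < l + 2) (h : clampN l t = i) : i ≤ t + 1 ∧ t + 1 - i < 3 := by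
  unfold clampN at h; split_ifs at h <;> omega

omit [NeZero n] hM in
/-- **AT MOST `3^d` OFFSETS PER CLAMPED BLOCK**: `Σ_{k ∈ KOff} h (clamp k) ≤ 3^d·Σ_{i ∈ KIn} h i` for `h ≥ 0` (`1 ≤ len_ν`). [folklore] -/
theorem sum_clamp_le (hlen : ∀ ν, 1 ≤ len ν) (h : (Fin d → ℕ) → ℝ) (hh : ∀ i, 0 ≤ h i) :
    ∑ k ∈ KOff len, h (clampK len k) ≤ 3 ^ d * ∑ i ∈ KIn len, h i := by
  classical
  rw [← Finset.sum_fiberwise_of_maps_to (s := KOff len) (t := KIn len) (g := clampK len) (fun k _ => clampK_mem_KIn len hlen k),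
    Finset.mul_sum]
  refine sum_le_sum fun i _ => ?_
  have hinner : ∑ k ∈ (KOff len).filter (fun k => clampK len k = i), h (clampK len k)
      = (((KOff len).filter (fun k => clampK len k = i)).card : ℝ) * h i := by
    rw [Finset.sum_congr rfl (fun k hk => by rw [(Finset.mem_filter.1 hk).2]), Finset.sum_const, nsmul_eq_mul]
  rw [hinner]
  refine mul_le_mul_of_nonneg_right ?_ (hh i)
  -- the fibre injects into `{0,1,2}^d` by `k ↦ k + 1 − i`
  have hcard : ((KOff len).filter (fun k => clampK len k = i)).card ≤ (Finset.univ : Finset (Fin d → Fin 3)).card := by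
    refine Finset.card_le_card_of_injOn (fun k ν => (⟨min (k ν + 1 - i ν) 2, by omega⟩ : Fin 3))
      (fun _ _ => Finset.mem_coe.2 (mem_univ _)) ?_
    intro k hk k' hk' hkk
    have hkO := (mem_KOff len).1 (mem_filter.1 (Finset.mem_coe.1 hk)).1
    have hkO' := (mem_KOff len).1 (mem_filter.1 (Finset.mem_coe.1 hk')).1
    have hkc := (mem_filter.1 (Finset.mem_coe.1 hk)).2
    have hkc' := (mem_filter.1 (Finset.mem_coe.1 hk')).2
    funext ν
    have h1 := clampN_fibre (ht := hkO ν) (congrFun hkc ν)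
    have h2 := clampN_fibre (ht := hkO' ν) (congrFun hkc' ν)
    have hν := congrArg (fun f : Fin d → Fin 3 => (f ν : ℕ)) hkk
    simp only at hν
    omega
  have : (Finset.univ : Finset (Fin d → Fin 3)).card = 3 ^ d := by
    rw [Finset.card_univ, Fintype.card_fun, Fintype.card_fin, Fintype.card_fin]
  rw [this] at hcard
  exact_mod_cast hcard

/-! ## §4 The gradient of the lift -/

/-- **THE GRADIENT OF THE BOX-COLLAR LIFT IS PAID BY THE BOX-INTERNAL DATA OF `g`** (`1 ≤ len_ν`, `len_ν + 2 ≤ M_ν`):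
`nsq (∂ (lift g)) ≤ 2·3^d·Σ_{i ∈ KIn} Σ_ρ GK_{i,ρ} + 2d·3^d·Σ_{i ∈ KIn} mass_i`. [folklore] -/
theorem nsq_grad_liftB_le (hlen : ∀ ν, 1 ≤ len ν) (hM2 : ∀ μ, len μ + 2 ≤ M μ) (g : Tor (fine n M) → ℂ) :
    nsq (GradOp (fine n M) (n : ℂ) *ᵥ liftB n M lo len g)
      ≤ 2 * 3 ^ d * ∑ i ∈ KIn len, ∑ ρ : Fin d, GK n M lo len g i ρ + 2 * d * 3 ^ d * ∑ i ∈ KIn len, massK n M lo g i := by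
  classical
  set Φ : Tor (fine n M) → ℝ :=
    fun x => ∑ ρ : Fin d, (n : ℝ) ^ 2 * ‖liftB n M lo len g (x + unitVec (fine n M) ρ) - liftB n M lo len g x‖ ^ 2 with hΦ
  have hnsq : nsq (GradOp (fine n M) (n : ℂ) *ᵥ liftB n M lo len g) = ∑ x, Φ x := by
    unfold nsq
    rw [Fintype.sum_prod_type]
    refine sum_congr rfl fun x _ => sum_congr rfl fun ρ _ => ?_
    rw [GradOp_mulVec, sdiff_mulVec, norm_mul, Complex.norm_natCast, mul_pow]
  have hΦ0 : ∀ x, x ∉ collarB n M lo len → Φ x = 0 := fun x hx =>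
    sum_eq_zero fun ρ _ => by rw [liftB_step_of_not_mem n M lo len hM2 g hx ρ, norm_zero]; simp
  rw [hnsq, sum_collarB_eq n M lo len hM2 Φ hΦ0]
  have hk : ∀ k ∈ KOff len, ∑ j, Φ (csiteB n M lo k j)
      ≤ 2 * ∑ ρ, GK n M lo len g (clampK len k) ρ + 2 * d * massK n M lo g (clampK len k) := by
    intro k hk
    have hkM := lt_M_of_mem_KOff M len hM2 hk
    have hpt : ∀ j, Φ (csiteB n M lo k j)
        ≤ ∑ ρ, (2 * DtermB n M lo len g k j ρ + 2 * ‖g (csiteB n M lo (clampK len k) (foldDB n len k j))‖ ^ 2) := by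
      intro j
      refine sum_le_sum fun ρ _ => ?_
      have h := liftB_step_sq_le n M lo len hlen hM2 g hk j ρ
      rw [foldB_csiteB n M lo len k hkM] at h
      exact h
    calc ∑ j, Φ (csiteB n M lo k j)
        ≤ ∑ j, ∑ ρ, (2 * DtermB n M lo len g k j ρ + 2 * ‖g (csiteB n M lo (clampK len k) (foldDB n len k j))‖ ^ 2) :=
          sum_le_sum fun j _ => hpt j
      _ = 2 * ∑ ρ, ∑ j, DtermB n M lo len g k j ρ + 2 * (d * ∑ j, ‖g (csiteB n M lo (clampK len k) (foldDB n len k j))‖ ^ 2) := by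
          rw [sum_comm]
          simp only [sum_add_distrib, ← mul_sum, sum_const, card_univ, Fintype.card_fin, nsmul_eq_mul]
      _ ≤ 2 * ∑ ρ, GK n M lo len g (clampK len k) ρ + 2 * (d * massK n M lo g (clampK len k)) :=
          add_le_add (mul_le_mul_of_nonneg_left (sum_le_sum fun ρ _ => sum_DtermB_le n M lo len hM2 g hk ρ) (by norm_num))
            (mul_le_mul_of_nonneg_left (mul_le_mul_of_nonneg_left
              (sum_foldDB_le n len k (fun j => ‖g (csiteB n M lo (clampK len k) j)‖ ^ 2) fun j => by positivity) (by positivity))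
              (by norm_num))
      _ = _ := by ring
  have hpos : ∀ i : Fin d → ℕ, 0 ≤ 2 * ∑ ρ, GK n M lo len g i ρ + 2 * d * massK n M lo g i := fun i => by
    have h1 : 0 ≤ ∑ ρ, GK n M lo len g i ρ :=
      sum_nonneg fun ρ _ => sum_nonneg fun _ _ => sq_nonneg _
    have h2 : 0 ≤ massK n M lo g i := sum_nonneg fun _ _ => sq_nonneg _
    have h3 : (0 : ℝ) ≤ 2 * d := by positivity
    exact add_nonneg (mul_nonneg (by norm_num) h1) (mul_nonneg h3 h2)
  have hfib : ∑ k ∈ KOff len, (2 * ∑ ρ, GK n M lo len g (clampK len k) ρ + 2 * d * massK n M lo g (clampK len k))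
      ≤ 3 ^ d * ∑ i ∈ KIn len, (2 * ∑ ρ, GK n M lo len g i ρ + 2 * d * massK n M lo g i) :=
    sum_clamp_le len hlen (fun i => 2 * ∑ ρ, GK n M lo len g i ρ + 2 * d * massK n M lo g i) hpos
  have hfinal : 3 ^ d * ∑ i ∈ KIn len, (2 * ∑ ρ, GK n M lo len g i ρ + 2 * d * massK n M lo g i)
      = 2 * 3 ^ d * ∑ i ∈ KIn len, ∑ ρ : Fin d, GK n M lo len g i ρ + 2 * d * 3 ^ d * ∑ i ∈ KIn len, massK n M lo g i := by
    rw [sum_add_distrib, ← mul_sum, ← mul_sum]; ring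
  exact ((sum_le_sum hk).trans hfib).trans hfinal.le

end Summit.QuantumFields.BalabanUV.T4Continuum.RegionBoxCollarLift

end
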